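import Summits.AtomisticToContinuum.Crystallization.Theorems.FrustratedLawDichotomyExemptSplit
import Summits.AtomisticToContinuum.Crystallization.Theorems.FrustratedLawDichotomyBumpSF45

/-!
# FrustratedLawDichotomy — the node «OptimalityCut» OF RECORD (lens-5 g38; critic row 534, order O3) — THIN WRAPPER

Column: crux `AperiodicFrustratedLawGap` (item 27623) of route `FrustratedLawDichotomy`.

Everything load-bearing is ALREADY IN THE TREE (hand-2 g14, `--supports 27623`): the `(ε, ϱ, K)`-local-optimality predicate `LocOpt` and its
inheritance depth `deepAbsent_locOptFails` (`…ExemptLocOpt`, p831061), the exempt door `localCloseOrder_of_exemptFDG` (`…ExemptDoor`, p830860),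
the split residuals with an allowance `SchurTopologicalPricingX` / `SchurElasticPricingX` and the positive-combination kernel
`schurRangeGapX_of_splitX` / `exemptFDG_of_splitX` / `aperiodicFrustratedLawGap_of_split_locOpt_fourHalf` (`…ExemptSplit`).  This file does NOT
restate any of it; it only FIXES THE NODE OF RECORD by name — the record rates `κ_T = 1/100`, `κ_E = 1/1000` of row 505's residual
`T′♭₄₅ ∧ E′♭₄₅`, `SF₄₅` discharged by the theorem `sf₄₅_holds` — and records the two sanity facts the doctrine asks for (the record residual
implies the new one; with the empty exemption the new one IS the record residual).

## The node

  `AperiodicFrustratedLawGap ⟸ MuEquilibriumDoor ∧ UP(−0.7175) ∧ 0 < ε ∧ 0 ≤ D_T ∧ 0 ≤ D_X ∧ Topt♭₄₅(ε, ϱ, K; C_T, D_T) ∧ Eopt♭₄₅(ε, ϱ, K; C_E, D_E, D_X)`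
  (`aperiodicFrustratedLawGap_of_optimalityCut_fourHalf`; `(ε, ϱ, K, D_T, D_X)` stay BOUND — literals are g39's, after the critic rules on
  `BATTERY-g38.md`).

## Pieces and tags

* `MuEquilibriumDoor` — SUPPORT · PROVED (item 27073 closed p816834; tree `GrainCoreNetworkSplitMuEquilibriumDoor.muEquilibriumDoor`, whose
  module does not co-import with this chain — hypothesis BY NAME).
* `UP(−0.7175)` — SUPPORT · PROVED (`periodicEnergyCeiling_holds` in the `Lean.ofReduceBool` leaf module `…PeriodicEnergyCeiling`; kept a
  hypothesis so that this file stays on the standard axioms).  `SF₄₅` — PROVED (`sf₄₅_holds`), discharged here.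
* DoorOpt (`localCloseOrder_of_exemptFDG` + `deepAbsent_locOptFails`) and the split kernel (`exemptFDG_of_splitX`) — SUPPORT · PROVED (tree).
* `Topt♭₄₅(ε, ϱ, K; C_T, D_T)` = `ToptFourHalf` — WEAKER than `T′♭₄₅(C_T)` (`toptFourHalf_of_orig`: implied by it, and `toptFourHalf_bot_iff`: equal
  to it when nothing is exempt; strictly weaker in substance because the adversary class shrinks from all `7/10`-legal clusters to
  `(ε, ϱ, K)`-equilibria — every killer of the one-shell books of g35–g37 is non-optimal by `≥ 40×` its deficit, AUDIT-g37 §D1, and is exempt) ·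
  UNDECIDED (stated test: the falsifier battery `BATTERY-g38.md` — 131 relaxed defect textures, 104 of them ε-equilibria; acceptance = every
  tight-free one-shell ball of an ε-equilibrium has flat book `≥ +1e-3`; finding of record: MET at `ρ = 3/2` (min `+2.76e-3`, the sheared-host
  background; every defect core `≥ +4.6e-3`), MISSED at `ρ = 23/20` on one family only, an equilibrium Z13-bearing platelet remnant (`+0.8e-4 …
  +1.3e-3` over five certified copies, never negative) — so the book radius of record becomes `3/2`) · INSTRUMENTABLE (one-shell book over ε-equilibria = branch-and-bound with first-order / exchange
  optimality cuts, hand-1's `exchangeUnstable_one_of_move` being the kernel of the cut; global form: periodic-cell ladder over equilibria).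
  Residuals named inside it: NEARCORE (tight-free equilibrium cores: Frank–Kasper / Z13–Z16 motifs, dislocation cores — IDEA-NEEDED, home
  ground of `Literature.Barriers.AtomisticToContinuum.TetrahedralFrustration`), FARFIELD (elastic far fields of equilibria — ATTACKABLE-L).
* `Eopt♭₄₅(ε, ϱ, K; C_E, D_E, D_X)` = `EoptFourHalf` — WEAKER than `E′♭₄₅(C_E, D_E)` likewise · ATTACKABLE-L · UNDECIDED-leaning-TRUE (hand-1 g14
  probe: all-strained periodic mode mixes reach `x̄ = +3.3e-4`, still positive, INBOX 675).

Why novel: optimality enters the finite pricing currency only as a COUNTING ALLOWANCE whose law-side cost is a proved inheritance depth,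
importing a hypothesis the column already owns (`MuEquilibriumDoor ⟹` a.e. `IsMuGSC`); no earlier pricing statement of this column, nor lens-2's
μGSC `J`-series (item 26636, which prices the infinite GSC directly), was quantified over an optimality-restricted class of FINITE clusters.
Why not costume: `T′♭ ⟹ Topt♭` is a theorem and the converse fails exactly on the non-equilibrium textures that closed the g35–g37 lane.

Evidence (cell HOME `run/shared/lean/pub/decomp-a2c/decomp-a2c-lens-5/`): `g37/AUDIT-g37.md` §D; `g38/BATTERY-g38.md`, `g38/logs/SUMMARY.txt`,
`g38/scripts/battery.py` (falsifier battery O4).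
-/

noncomputable section

namespace Summit.AtomisticToContinuum.Crystallization.Theorems.FrustratedLawDichotomyOptimalityCut

open Literature.MathematicalPhysics.StatisticalMechanics
open Summit.AtomisticToContinuum.Crystallization.Theorems.ChargedEnergyGapNegative (E3 eStar)
open Summit.AtomisticToContinuum.Crystallization.Theorems.FrustratedLawDichotomyExemptDoor
open Summit.AtomisticToContinuum.Crystallization.Theorems.FrustratedLawDichotomyExemptLocOpt (LocOpt LocOptFails deepAbsent_locOptFails)
open Summit.AtomisticToContinuum.Crystallization.Theorems.FrustratedLawDichotomyExemptSplit
  (SchurTopologicalPricingX SchurElasticPricingX schurTopologicalPricingX_of_orig schurElasticPricingX_of_orig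
    aperiodicFrustratedLawGap_of_split_locOpt_fourHalf aperiodicFrustratedLawGap_of_splitX periodicFrustratedLawGap_of_splitX)
open Summit.AtomisticToContinuum.Crystallization.Theorems.FrustratedLawDichotomyRangeCut (Sep GoodAt goodCount PeriodicEnergyCeiling)
open Summit.AtomisticToContinuum.Crystallization.Theorems.FrustratedLawDichotomySchurCut
  (SchurTopologicalPricing SchurElasticPricing w₄₅ ω₄ SF₄₅)
open Summit.AtomisticToContinuum.Crystallization.Theorems.FrustratedLawDichotomyBumpAutocorrelation (sf₄₅_holds)

/-! ## §1. The node of record BY NAME (record rates `κ_T = 1/100`, `κ_E = 1/1000`; `(ε, ϱ, K, D_T, D_X)` bound) -/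

/-- **`Topt♭₄₅(ε, ϱ, K; C_T, D_T)`**: `−0.7175·N + (1/100)·(N − #Good(1/8)) − C_T·#Good(1/20) − D_T·#{i : ¬LocOpt e⋆ ε ϱ K y i} ≤ Σ_{i<j} W₄₅(r_ij) − (3/400)·N`
for every finite injective `7/10`-separated cluster — the tree's `SchurTopologicalPricingX` at the record instance.
[WEAKER than `T′♭₄₅(C_T)`; UNDECIDED (test: `BATTERY-g38.md`); INSTRUMENTABLE; residuals NEARCORE (IDEA-NEEDED) / FARFIELD (ATTACKABLE-L)] -/
def ToptFourHalf (ε ϱ : ℝ) (K : ℕ) (CT DT : ℝ) : Prop :=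
  SchurTopologicalPricingX (1 / 20) (1 / 8) w₄₅ ω₄ (3 / 400) (-(7175 / 10000)) (1 / 100) CT DT (LocOptFails eStar ε ϱ K)

/-- **`Eopt♭₄₅(ε, ϱ, K; C_E, D_E, D_X)`** — the tree's `SchurElasticPricingX` at the record instance (`κ_E = 1/1000`).
[WEAKER than `E′♭₄₅(C_E, D_E)`; ATTACKABLE-L; UNDECIDED-leaning-TRUE] -/
def EoptFourHalf (ε ϱ : ℝ) (K : ℕ) (CE DE DX : ℝ) : Prop :=
  SchurElasticPricingX (1 / 20) (1 / 8) w₄₅ ω₄ (3 / 400) (-(7175 / 10000)) (1 / 1000) CE DE DX (LocOptFails eStar ε ϱ K)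

/-- ★ **THE NODE «OptimalityCut»**: `MuEquilibriumDoor ∧ UP(−0.7175) ∧ 0 < ε ∧ 0 ≤ D_T ∧ 0 ≤ D_X ∧ Topt♭₄₅ ∧ Eopt♭₄₅ ⟹ AperiodicFrustratedLawGap`
(item 27623), `SF₄₅` discharged by `sf₄₅_holds`; the kernel is the tree's `aperiodicFrustratedLawGap_of_split_locOpt_fourHalf`. [folklore] -/
theorem aperiodicFrustratedLawGap_of_optimalityCut_fourHalf {ε ϱ CT DT CE DE DX : ℝ} {K : ℕ}
    (hDoor : Summit.AtomisticToContinuum.Crystallization.Theses.GrainCoreNetworkSplit.MuEquilibriumDoor)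
    (hU : PeriodicEnergyCeiling (-(7175 / 10000))) (hε : 0 < ε) (hDT : 0 ≤ DT) (hDX : 0 ≤ DX)
    (hT : ToptFourHalf ε ϱ K CT DT) (hE : EoptFourHalf ε ϱ K CE DE DX) :
    Summit.AtomisticToContinuum.Crystallization.Theses.FrustratedLawDichotomy.AperiodicFrustratedLawGap :=
  aperiodicFrustratedLawGap_of_split_locOpt_fourHalf hDoor sf₄₅_holds hU hε (by norm_num) hDT hT (by norm_num) hDX hE

/-- The sibling item 27624 `PeriodicFrustratedLawGap` from the same node. [folklore] -/
theorem periodicFrustratedLawGap_of_optimalityCut_fourHalf {ε ϱ CT DT CE DE DX : ℝ} {K : ℕ}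
    (hDoor : Summit.AtomisticToContinuum.Crystallization.Theses.GrainCoreNetworkSplit.MuEquilibriumDoor)
    (hU : PeriodicEnergyCeiling (-(7175 / 10000))) (hε : 0 < ε) (hDT : 0 ≤ DT) (hDX : 0 ≤ DX)
    (hT : ToptFourHalf ε ϱ K CT DT) (hE : EoptFourHalf ε ϱ K CE DE DX) :
    Summit.AtomisticToContinuum.Crystallization.Theses.FrustratedLawDichotomy.PeriodicFrustratedLawGap :=
  periodicFrustratedLawGap_of_splitX hDoor (by norm_num) sf₄₅_holds hU (deepAbsent_locOptFails hε)
    (by norm_num) hDT hT (by norm_num) hDX hE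

/-! ## §2. Sanity (doctrine): the record residual implies the node; with nothing exempt the node IS the record residual -/

/-- `T′♭₄₅(C_T) ⟹ Topt♭₄₅(ε, ϱ, K; C_T, D_T)` for every `D_T ≥ 0`. [folklore] -/
theorem toptFourHalf_of_orig {ε ϱ CT DT : ℝ} {K : ℕ} (hD : 0 ≤ DT)
    (h : SchurTopologicalPricing (1 / 20) (1 / 8) w₄₅ ω₄ (3 / 400) (-(7175 / 10000)) (1 / 100) CT) : ToptFourHalf ε ϱ K CT DT :=
  (schurTopologicalPricingX_of_orig h _).mono hD

/-- `E′♭₄₅(C_E, D_E) ⟹ Eopt♭₄₅(ε, ϱ, K; C_E, D_E, D_X)` for every `D_X ≥ 0`. [folklore] -/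
theorem eoptFourHalf_of_orig {ε ϱ CE DE DX : ℝ} {K : ℕ} (hD : 0 ≤ DX)
    (h : SchurElasticPricing (1 / 20) (1 / 8) w₄₅ ω₄ (3 / 400) (-(7175 / 10000)) (1 / 1000) CE DE) : EoptFourHalf ε ϱ K CE DE DX := by
  intro N y hy hsep
  have h1 := schurElasticPricingX_of_orig h (LocOptFails eStar ε ϱ K) N y hy hsep
  have he0 : (0 : ℝ) ≤ Nat.card {i : Fin N // LocOptFails eStar ε ϱ K N y i} := Nat.cast_nonneg _
  nlinarith [mul_nonneg hD he0]

/-- **No regression**: the record residual `T′♭₄₅(C_T) ∧ E′♭₄₅(C_E, D_E)` still closes the crux THROUGH the new node (`D = 0`, any `ε > 0`).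
(An `example`, not a theorem: as a STATEMENT it coincides with the tree's `…BumpAutocorrelation.aperiodicFrustratedLawGap_of_residuals_fourHalf`
— gate dedup at landing, hand-2 g15.) [folklore] -/
example {CT CE DE : ℝ}
    (hDoor : Summit.AtomisticToContinuum.Crystallization.Theses.GrainCoreNetworkSplit.MuEquilibriumDoor)
    (hU : PeriodicEnergyCeiling (-(7175 / 10000)))
    (hT : SchurTopologicalPricing (1 / 20) (1 / 8) w₄₅ ω₄ (3 / 400) (-(7175 / 10000)) (1 / 100) CT)
    (hE : SchurElasticPricing (1 / 20) (1 / 8) w₄₅ ω₄ (3 / 400) (-(7175 / 10000)) (1 / 1000) CE DE) :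
    Summit.AtomisticToContinuum.Crystallization.Theses.FrustratedLawDichotomy.AperiodicFrustratedLawGap :=
  aperiodicFrustratedLawGap_of_optimalityCut_fourHalf (ε := 1) (ϱ := 1) (K := 1) (DT := 0) (DX := 0) hDoor hU one_pos le_rfl le_rfl
    (toptFourHalf_of_orig le_rfl hT) (eoptFourHalf_of_orig le_rfl hE)

/-- With the EMPTY exemption the allowance vanishes: `SchurTopologicalPricingX … D_T ⊥ ↔ SchurTopologicalPricing …` (any `D_T`) — the new
statement differs from the record one exactly on the exempt (non-equilibrium) sites. [folklore] -/
theorem schurTopologicalPricingX_bot_iff {η₀ η₁ : ℝ} {w ω : ℝ → ℝ} {A eUp κT CT DT : ℝ} :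
    SchurTopologicalPricingX η₀ η₁ w ω A eUp κT CT DT (fun _ _ _ => False) ↔ SchurTopologicalPricing η₀ η₁ w ω A eUp κT CT := by
  have hz : ∀ (N : ℕ), (Nat.card {i : Fin N // False} : ℝ) = 0 := fun N => by
    haveI : IsEmpty {i : Fin N // False} := ⟨fun i => i.2⟩
    exact_mod_cast Nat.card_of_isEmpty
  constructor
  · intro h N y hy hsep
    have h1 := h N y hy hsep
    rw [hz N] at h1
    linarith
  · intro h N y hy hsep
    have h1 := h N y hy hsep
    rw [hz N]
    linarith

/-- The same for the elastic residual. [folklore] -/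
theorem schurElasticPricingX_bot_iff {η₀ η₁ : ℝ} {w ω : ℝ → ℝ} {A eUp κE CE DE DX : ℝ} :
    SchurElasticPricingX η₀ η₁ w ω A eUp κE CE DE DX (fun _ _ _ => False) ↔ SchurElasticPricing η₀ η₁ w ω A eUp κE CE DE := by
  have hz : ∀ (N : ℕ), (Nat.card {i : Fin N // False} : ℝ) = 0 := fun N => by
    haveI : IsEmpty {i : Fin N // False} := ⟨fun i => i.2⟩
    exact_mod_cast Nat.card_of_isEmpty
  constructor
  · intro h N y hy hsep
    have h1 := h N y hy hsep
    rw [hz N] at h1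
    linarith
  · intro h N y hy hsep
    have h1 := h N y hy hsep
    rw [hz N]
    linarith

/-- Monotone in the exemption: a LARGER exempt class gives a WEAKER statement (`D_T ≥ 0`) — so `(ε ↓, ϱ ↑, K ↑)` only weaken `Topt♭`. [folklore] -/
theorem SchurTopologicalPricingX.of_imp {η₀ η₁ : ℝ} {w ω : ℝ → ℝ} {A eUp κT CT DT : ℝ} {Ex Ex' : SitePred} (hD : 0 ≤ DT)
    (h : SchurTopologicalPricingX η₀ η₁ w ω A eUp κT CT DT Ex)
    (himp : ∀ (N : ℕ) (y : Fin N → EuclideanSpace ℝ (Fin 3)) (i : Fin N), Ex N y i → Ex' N y i) :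
    SchurTopologicalPricingX η₀ η₁ w ω A eUp κT CT DT Ex' := by
  intro N y hy hsep
  have h1 := h N y hy hsep
  have hle : (Nat.card {i : Fin N // Ex N y i} : ℝ) ≤ Nat.card {i : Fin N // Ex' N y i} := by
    exact_mod_cast Nat.card_le_card_of_injective
      (fun i : {i : Fin N // Ex N y i} => (⟨i.1, himp N y i.1 i.2⟩ : {i : Fin N // Ex' N y i}))
      fun a b hab => Subtype.ext (by simpa using congrArg Subtype.val hab)
  nlinarith [mul_le_mul_of_nonneg_left hle hD]

/-- The same for the elastic residual (`D_X ≥ 0`). [folklore] -/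
theorem SchurElasticPricingX.of_imp {η₀ η₁ : ℝ} {w ω : ℝ → ℝ} {A eUp κE CE DE DX : ℝ} {Ex Ex' : SitePred} (hD : 0 ≤ DX)
    (h : SchurElasticPricingX η₀ η₁ w ω A eUp κE CE DE DX Ex)
    (himp : ∀ (N : ℕ) (y : Fin N → EuclideanSpace ℝ (Fin 3)) (i : Fin N), Ex N y i → Ex' N y i) :
    SchurElasticPricingX η₀ η₁ w ω A eUp κE CE DE DX Ex' := by
  intro N y hy hsep
  have h1 := h N y hy hsep
  have hle : (Nat.card {i : Fin N // Ex N y i} : ℝ) ≤ Nat.card {i : Fin N // Ex' N y i} := by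
    exact_mod_cast Nat.card_le_card_of_injective
      (fun i : {i : Fin N // Ex N y i} => (⟨i.1, himp N y i.1 i.2⟩ : {i : Fin N // Ex' N y i}))
      fun a b hab => Subtype.ext (by simpa using congrArg Subtype.val hab)
  nlinarith [mul_le_mul_of_nonneg_left hle hD]

end Summit.AtomisticToContinuum.Crystallization.Theorems.FrustratedLawDichotomyOptimalityCut

end
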